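import Literature.Geometry.Riemannian.HarmonicMaps
import Literature.Geometry.Riemannian.RiemannianMeasureIsometry
import Literature.Geometry.Lorentzian.IsometryProofs
import Literature.Geometry.Lorentzian.CurvatureRegularity
import HarnessLib

/-!
# Pulling back a Riemannian metric along a local diffeomorphism; naturality of the energy
(topic `Geometry/Riemannian`)

* `riemannianComap g f hf hf' hdim` — the **pullback Riemannian metric** `f^* g` of a `C^n`
  Riemannian metric `g` on `TM₂` (Mathlib's `Bundle.ContMDiffRiemannianMetric`) along a `C^{n+1}`
  immersion `f : M₁ → M₂` between manifolds of equal dimension (O'Neill 1983, Ch. 3, Def. 3.9,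
  pp. 90–91); the Riemannian sibling of the tree's `PseudoRiemannianMetric.comap`
  (`Lorentzian/Isometry.lean`), smooth by `PseudoRiemannianMetric.contMDiff_pullbackBilin_holds`;
* `trace_riemannianComap` — the metric trace is invariant: `tr_{f^*g}(B ∘ (df × df)) = tr_g B`;
* `energyDensity_comp_riemannianComap` — **naturality of the energy density**
  `e_{f^*g}(φ ∘ f) = e_g(φ) ∘ f` (Eells–Ratto 1993, Ch. I (1.3));
* `energy_comp_riemannianComap` — for a `C^∞` diffeomorphism `Ψ`, `E_{Ψ^*g}(φ ∘ Ψ) = E_g(φ)`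
  (with the invariance of the Riemannian measure, `RiemannianMeasureIsometry.lean`);
* `isHarmonicMap_comp_iff` — **harmonicity is invariant under isometric diffeomorphisms**:
  `IsHarmonicMap (Ψ^* g) h (φ ∘ Ψ) ↔ IsHarmonicMap g h φ` (Eells–Ratto 1993, Ch. I (1.8)).

In particular the tree's variational notion `IsHarmonicMap` does not depend on the model space
charting the source — the transport used by `EellsSampsonModelReduction.lean`. Everything is
proved; the only definition is `riemannianComap`; no named facts.

## Relation to the tree

`PseudoRiemannianMetric.comap` (`Lorentzian/Isometry.lean`) is the same construction for the
tree's pseudo-Riemannian structure (nondegeneracy instead of positivity; no unit-ball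
boundedness field), and `PseudoRiemannianMetric.transportCLE` (`ModelTransportMetric.lean`) its
special case along Mathlib's `transContinuousLinearEquiv` change of model vector space on the
same charted space. The present `riemannianComap` produces Mathlib's positive-definite
`Bundle.ContMDiffRiemannianMetric`, which is what the energy functional, the Riemannian measure
`riemannianMeasure` and `IsHarmonicMap` consume, and works along an arbitrary equidimensional
immersion (here: the identity onto the interior re-modelled on `ℝ^m`, whose model becomes
boundaryless). The measure-theoretic input is `RiemannianMeasureIsometry.lean` (plain maps with
`g₂(dΨ v, dΨ v) = g₁(v, v)`); `Lorentzian/RiemannianVolumeIsometry.lean` has the parallel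
statements for bundled `Diffeomorph`s and `IsIsometry`.

## References

* B. O'Neill, *Semi-Riemannian Geometry* (1983), Ch. 3, Def. 3.9, pp. 58, 60–61, 90–91.
  [ONeill1983]
* J. Eells, A. Ratto, *Harmonic Maps and Minimal Immersions with Symmetries* (1993), Ch. I,
  (1.3), (1.4), (1.8). [EellsRatto1993]
-/

noncomputable section

open Bundle Set Function Filter MeasureTheory Manifold
open scoped Manifold ContDiff Topology

namespace Literature.Geometry.Riemannian

open Lorentzian Lorentzian.PseudoRiemannianMetric HarmonicMap

variable {E₁ : Type*} [NormedAddCommGroup E₁] [NormedSpace ℝ E₁] [FiniteDimensional ℝ E₁]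
  {H₁ : Type*} [TopologicalSpace H₁] {I₁ : ModelWithCorners ℝ E₁ H₁}
  {M₁ : Type*} [TopologicalSpace M₁] [ChartedSpace H₁ M₁] [IsManifold I₁ ∞ M₁]
  {E₂ : Type*} [NormedAddCommGroup E₂] [NormedSpace ℝ E₂] [FiniteDimensional ℝ E₂]
  {H₂ : Type*} [TopologicalSpace H₂] {I₂ : ModelWithCorners ℝ E₂ H₂}
  {M₂ : Type*} [TopologicalSpace M₂] [ChartedSpace H₂ M₂] [IsManifold I₂ ∞ M₂] {n : ℕ∞ω}

/-! ### The pullback Riemannian metric -/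

/-- `∞ + 1 ≤ ∞` in `ℕ∞ω` (cast bookkeeping: `∞ = ↑(⊤ : ℕ∞)`). [folklore] -/
private theorem infty_add_one_le : (∞ : ℕ∞ω) + 1 ≤ ∞ := by
  exact_mod_cast (le_top : (⊤ : ℕ∞) + 1 ≤ ⊤)

/-- The **pullback Riemannian metric** `f^* g` of a `C^n` Riemannian metric `g` on `TM₂` along a
`C^{n+1}` immersion `f : M₁ → M₂` between manifolds of the same dimension (a local diffeomorphism):
`(f^* g)_x (v, w) = g_{f x} (df_x v, df_x w)`; positive definite because `df_x` is injective, with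
bounded unit ball because `df_x` is a linear isomorphism, and `C^n`
(`PseudoRiemannianMetric.contMDiff_pullbackBilin_holds`). This is the Riemannian sibling of the
tree's `PseudoRiemannianMetric.comap` (`Lorentzian/Isometry.lean`). O'Neill 1983, Ch. 3, Def. 3.9
and pp. 90–91. [cite: ONeill1983, Ch. 3, Def. 3.9 and pp. 90–91] -/
def riemannianComap (g : ContMDiffRiemannianMetric I₂ n E₂ (TangentSpace I₂ : M₂ → Type _))
    (f : M₁ → M₂) (hf : ContMDiff I₁ I₂ (n + 1) f)
    (hf' : ∀ x, Function.Injective (mfderiv I₁ I₂ f x))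
    (hdim : Module.finrank ℝ E₁ = Module.finrank ℝ E₂) :
    ContMDiffRiemannianMetric I₁ n E₁ (TangentSpace I₁ : M₁ → Type _) where
  inner := pullbackBilin (I := I₂) (I' := I₁) f g.inner
  symm x v w := g.symm (f x) _ _
  pos x v hv := by
    simp only [pullbackBilin_apply]
    exact g.pos (f x) _ fun h0 ↦ hv (hf' x (by rw [h0, map_zero]))
  isVonNBounded x := by
    -- read in the model spaces `E₁ = T_x M₁`, `E₂ = T_{f x} M₂`, `df_x` is a linear isomorphism
    have hbij := mfderiv_bijective_of_injective (I := I₂) (I' := I₁) (hf' x) hdim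
    let L0 : E₁ ≃ₗ[ℝ] E₂ := LinearEquiv.ofBijective (mfderiv I₁ I₂ f x).toLinearMap hbij
    let L : E₁ ≃L[ℝ] E₂ := L0.toContinuousLinearEquiv
    have hL : ∀ v, L v = mfderiv I₁ I₂ f x v := fun v ↦ rfl
    have hset : {v : TangentSpace I₁ x | pullbackBilin (I := I₂) (I' := I₁) f g.inner x v v < 1} =
        (L.symm : E₂ →L[ℝ] E₁) '' {w : TangentSpace I₂ (f x) | g.inner (f x) w w < 1} := by
      ext v
      simp only [mem_setOf_eq, pullbackBilin_apply]
      constructor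
      · intro hv
        refine ⟨mfderiv I₁ I₂ f x v, hv, ?_⟩
        rw [← hL]
        exact L.symm_apply_apply v
      · rintro ⟨w, hw, rfl⟩
        have h1 : mfderiv I₁ I₂ f x ((L.symm : E₂ →L[ℝ] E₁) w) = w := by
          rw [← hL]
          exact L.apply_symm_apply w
        rw [h1]
        exact hw
    rw [hset]
    exact (g.isVonNBounded (f x)).image (L.symm : E₂ →L[ℝ] E₁)
  contMDiff := (contMDiff_pullbackBilin_holds (I := I₂) (I' := I₁) (n := n)) f hf (ofRiemannian g)

section API

variable (g : ContMDiffRiemannianMetric I₂ n E₂ (TangentSpace I₂ : M₂ → Type _))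
  {f : M₁ → M₂} (hf : ContMDiff I₁ I₂ (n + 1) f)
  (hf' : ∀ x, Function.Injective (mfderiv I₁ I₂ f x))
  (hdim : Module.finrank ℝ E₁ = Module.finrank ℝ E₂)

/-- `(f^* g)_x (v, w) = g_{f x}(df_x v, df_x w)`. [cite: ONeill1983, Ch. 3, Def. 3.9] -/
@[simp]
theorem riemannianComap_inner (x : M₁) (v w : TangentSpace I₁ x) :
    (riemannianComap g f hf hf' hdim).inner x v w =
      g.inner (f x) (mfderiv I₁ I₂ f x v) (mfderiv I₁ I₂ f x w) := rfl

/-- The pseudo-Riemannian bridge of `f^* g` evaluates as `g_{f x}(df v, df w)`. [folklore] -/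
@[simp]
theorem val_ofRiemannian_riemannianComap (x : M₁) (v w : TangentSpace I₁ x) :
    (ofRiemannian (riemannianComap g f hf hf' hdim)).val x v w =
      g.inner (f x) (mfderiv I₁ I₂ f x v) (mfderiv I₁ I₂ f x w) := rfl

/-- **The metric trace is invariant under pullback**: for a bilinear form `B` on `T_{f x} M₂`,
`tr_{(f^*g)_x} (B ∘ (df_x × df_x)) = tr_{g_{f x}} B` (compute both traces in a basis `β` of
`T_x M₁` and its image `df_x β`, `trace_eq_sum_gram_inv`: the Gram matrices and the entries of
the forms coincide). O'Neill 1983, Ch. 3, pp. 60–61. [cite: ONeill1983, Ch. 3, pp. 60–61] -/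
theorem trace_riemannianComap (x : M₁) (B : LinearMap.BilinForm ℝ (TangentSpace I₂ (f x))) :
    (ofRiemannian (riemannianComap g f hf hf' hdim)).trace x
        (B.comp (mfderiv I₁ I₂ f x).toLinearMap (mfderiv I₁ I₂ f x).toLinearMap) =
      (ofRiemannian g).trace (f x) B := by
  classical
  haveI : FiniteDimensional ℝ (TangentSpace I₁ x) := inferInstanceAs (FiniteDimensional ℝ E₁)
  haveI : FiniteDimensional ℝ (TangentSpace I₂ (f x)) := inferInstanceAs (FiniteDimensional ℝ E₂)
  set L := mfderivEquivOfInjective (I := I₂) (I' := I₁) f x (hf' x) hdim with hL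
  set β := Module.finBasis ℝ (TangentSpace I₁ x) with hβ
  rw [trace_eq_sum_gram_inv _ x β, trace_eq_sum_gram_inv _ (f x) (β.map L)]
  simp only [Module.Basis.map_apply, hL, mfderivEquivOfInjective_apply, LinearMap.BilinForm.comp_apply,
    ContinuousLinearMap.coe_coe, val_ofRiemannian, riemannianComap_inner]

variable {EN : Type*} [NormedAddCommGroup EN] [NormedSpace ℝ EN]
  {HN : Type*} [TopologicalSpace HN] {IN : ModelWithCorners ℝ EN HN}
  {N : Type*} [TopologicalSpace N] [ChartedSpace HN N] [IsManifold IN ∞ N]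

/-- **The energy density is natural under local isometries**: `e_{f^* g}(φ ∘ f)(x) = e_g(φ)(f x)`
for `φ` differentiable at `f x` (chain rule `d(φ ∘ f) = dφ ∘ df` and `trace_riemannianComap`).
Eells–Ratto 1993, Ch. I (1.3); O'Neill 1983, Ch. 3, p. 90. [cite: EellsRatto1993, Ch. I (1.3)] -/
theorem energyDensity_comp_riemannianComap
    (g₂ : ContMDiffRiemannianMetric I₂ ∞ E₂ (TangentSpace I₂ : M₂ → Type _))
    (hfs : ContMDiff I₁ I₂ ∞ f) (h : PseudoRiemannianMetric IN ∞ EN (TangentSpace IN : N → Type _))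
    {φ : M₂ → N} (x : M₁) (hφ : MDifferentiableAt I₂ IN φ (f x)) :
    energyDensity (riemannianComap g₂ f (hfs.of_le infty_add_one_le) hf' hdim) h (φ ∘ f) x =
      energyDensity g₂ h φ (f x) := by
  have hfx : MDifferentiableAt I₁ I₂ f x := (hfs x).mdifferentiableAt (by simp)
  rw [energyDensity_eq, energyDensity_eq]
  congr 1
  have hB : (pullbackBilin (I := IN) (I' := I₁) (φ ∘ f) h.val x).toLinearMap₁₂ =
      LinearMap.BilinForm.comp (pullbackBilin (I := IN) (I' := I₂) φ h.val (f x)).toLinearMap₁₂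
        (mfderiv I₁ I₂ f x).toLinearMap (mfderiv I₁ I₂ f x).toLinearMap := by
    ext v w
    simp only [ContinuousLinearMap.toLinearMap₁₂_apply, pullbackBilin_apply,
      LinearMap.BilinForm.comp_apply, ContinuousLinearMap.coe_coe]
    rw [mfderiv_comp x hφ hfx]
    rfl
  rw [hB]
  exact trace_riemannianComap g₂ (hfs.of_le infty_add_one_le) hf' hdim x _

end API

/-! ### The energy and harmonicity under isometric diffeomorphisms -/

section Energy

variable [T3Space M₁] [MeasurableSpace M₁] [BorelSpace M₁]
  [T3Space M₂] [MeasurableSpace M₂] [BorelSpace M₂]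
  {EN : Type*} [NormedAddCommGroup EN] [NormedSpace ℝ EN]
  {HN : Type*} [TopologicalSpace HN] {IN : ModelWithCorners ℝ EN HN}
  {N : Type*} [TopologicalSpace N] [ChartedSpace HN N] [IsManifold IN ∞ N]
  (g₂ : ContMDiffRiemannianMetric I₂ ∞ E₂ (TangentSpace I₂ : M₂ → Type _))
  (h : PseudoRiemannianMetric IN ∞ EN (TangentSpace IN : N → Type _))
  {Ψ : M₁ → M₂} {Ψ' : M₂ → M₁} (hΨ : ContMDiff I₁ I₂ ∞ Ψ) (hΨ' : ContMDiff I₂ I₁ ∞ Ψ')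
  (hleft : LeftInverse Ψ' Ψ) (hright : RightInverse Ψ' Ψ)
  (hΨinj : ∀ x, Function.Injective (mfderiv I₁ I₂ Ψ x))
  (hdim : Module.finrank ℝ E₁ = Module.finrank ℝ E₂)

include hΨ' hleft hright in
/-- **The energy is invariant under isometric diffeomorphisms**: `E_{Ψ^* g}(φ ∘ Ψ) = E_g(φ)` for a
`C^∞` diffeomorphism `Ψ : M₁ → M₂` and `φ` differentiable (pointwise naturality of the energy
density and invariance of the Riemannian measure, `integral_comp_of_isometry`).
Eells–Ratto 1993, Ch. I (1.4). [cite: EellsRatto1993, Ch. I (1.4)] -/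
theorem energy_comp_riemannianComap {φ : M₂ → N} (hφ : MDifferentiable I₂ IN φ) :
    energy (riemannianComap g₂ Ψ (hΨ.of_le infty_add_one_le) hΨinj hdim) h (φ ∘ Ψ) = energy g₂ h φ := by
  rw [energy_eq, energy_eq]
  simp only [energyDensity_comp_riemannianComap hΨinj hdim g₂ hΨ h _ (hφ _)]
  exact integral_comp_of_isometry (riemannianComap g₂ Ψ (hΨ.of_le infty_add_one_le) hΨinj hdim) g₂
    (hΨ.of_le (by norm_cast)) (hΨ'.of_le (by norm_cast)) hleft hright
    (fun x v ↦ rfl) hdim (fun y ↦ energyDensity g₂ h φ y)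

include hΨ' hleft hright in
/-- **Harmonicity is invariant under isometric diffeomorphisms**: `φ : (M₂, g) → (N, h)` is
harmonic iff `φ ∘ Ψ : (M₁, Ψ^* g) → (N, h)` is, for a `C^∞` diffeomorphism `Ψ` (deformations of
`φ` and of `φ ∘ Ψ` correspond under composition with `Ψ`, `Ψ⁻¹`, with equal energies,
`energy_comp_riemannianComap`). In particular the notion `IsHarmonicMap` does not depend on the
model space charting the source. Eells–Ratto 1993, Ch. I (1.8). [cite: EellsRatto1993, Ch. I (1.8)] -/
theorem isHarmonicMap_comp_iff {φ : M₂ → N} :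
    IsHarmonicMap (riemannianComap g₂ Ψ (hΨ.of_le infty_add_one_le) hΨinj hdim) h (φ ∘ Ψ) ↔
      IsHarmonicMap g₂ h φ := by
  constructor
  · rintro ⟨hφΨ, hcrit⟩
    have hφ : ContMDiff I₂ IN ∞ φ := by
      have : φ = (φ ∘ Ψ) ∘ Ψ' := funext fun y ↦ by simp [hright y]
      rw [this]; exact hφΨ.comp hΨ'
    refine ⟨hφ, fun F hF hF0 ↦ ?_⟩
    have hF₁ : ContMDiff (𝓘(ℝ, ℝ).prod I₁) IN ∞ (fun p : ℝ × M₁ ↦ F p.1 (Ψ p.2)) :=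
      hF.comp (contMDiff_fst.prodMk (hΨ.comp contMDiff_snd))
    have hd := hcrit (fun t x ↦ F t (Ψ x)) hF₁ (by funext x; simp [hF0])
    have hEt : ∀ t, energy (riemannianComap g₂ Ψ (hΨ.of_le infty_add_one_le) hΨinj hdim) h
        (fun x ↦ F t (Ψ x)) = energy g₂ h (F t) := fun t ↦
      energy_comp_riemannianComap g₂ h hΨ hΨ' hleft hright hΨinj hdim (φ := F t)
        ((hF.comp (contMDiff_const.prodMk contMDiff_id)).mdifferentiable (by simp))
    simp only [hEt] at hd
    exact hd
  · rintro ⟨hφ, hcrit⟩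
    refine ⟨hφ.comp hΨ, fun F₁ hF₁ hF₁0 ↦ ?_⟩
    have hF : ContMDiff (𝓘(ℝ, ℝ).prod I₂) IN ∞ (fun p : ℝ × M₂ ↦ F₁ p.1 (Ψ' p.2)) :=
      hF₁.comp (contMDiff_fst.prodMk (hΨ'.comp contMDiff_snd))
    have hd := hcrit (fun t y ↦ F₁ t (Ψ' y)) hF (by
      funext y; simp only [hF₁0, Function.comp_apply, hright y])
    have hEt : ∀ t, energy g₂ h (fun y ↦ F₁ t (Ψ' y)) =
        energy (riemannianComap g₂ Ψ (hΨ.of_le infty_add_one_le) hΨinj hdim) h (F₁ t) := by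
      intro t
      have hdiff : MDifferentiable I₂ IN (fun y ↦ F₁ t (Ψ' y)) :=
        ((hF₁.comp (contMDiff_const.prodMk contMDiff_id)).comp hΨ').mdifferentiable (by simp)
      have := energy_comp_riemannianComap g₂ h hΨ hΨ' hleft hright hΨinj hdim
        (φ := fun y ↦ F₁ t (Ψ' y)) hdiff
      rw [← this]
      congr 1
      funext x
      simp [hleft x]
    simp only [hEt] at hd
    exact hd

end Energy

end Literature.Geometry.Riemannian

end
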